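import Summits.BirchSwinnertonDyer.Rank1Residual.Supersingular.X7KuriharaKP3OfferShape
import HarnessLib

/-!
# X6 at `p = 3` (N4@3 = X6 ∧ `r_an = 0`: semistable, good supersingular, `a_3 = 0`) PER-PAIR OFFER SHAPES: `BSD(E,3)` from the
# literal integer equation, a LANDED `CertifiedOddL` twist record + rounding certificate, KERNEL certificates for everything
# decidable (minimality, class X6, the cyclic Kolyvagin level from point counts + cube tests, the discrete logarithms), and
# EXACTLY the binders {Kim 2025 Thm 1.1 (OPEN), the published named facts, `D`, `r_an = 0`, the `L`-value enclosure}

Cell `b2b-bsdres`, supersingular family, prover A = unit `b2b-bsdres-x10b` (gen 13; X6 = A's class, HOME/CLASS-OWNERS.md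
X6 row); the X6 twin of prover B's `X7KuriharaKP3OfferShape.lean` / `X8KuriharaKP3OfferShape.lean` (additive-p3 gen 22) —
"the N5@3 shape minus the additive prime", as B put it (INBOX 2026-08-22T00:20Z).  Topic file; namespace
`Summit.BirchSwinnertonDyer.Rank1Residual.Supersingular`.  THEOREMS ONLY (compositions of tree theorems by name); no named
fact, no definition, nothing asserted about any curve, nothing booked; X6 stays CONSTRUCTION-SHAPED (RESIDUAL-MAP §I N4).

HONEST FRAMING (run/shared/lean/b2b/bsd-rank1-residual/, verbatim in every file): the goal of the
cell is to DELETE the COMBINATION-SHAPED residual classes of the Birch–Swinnerton-Dyer formula for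
ALL analytic-rank `≤ 1` elliptic curves over `ℚ` — "full BSD formula for every rank `≤ 1` curve in
class `C`" assembled STRICTLY from published theorems — so that the rank-`≤ 1` remainder becomes
exactly the CONSTRUCTION-SHAPED classes, which are TYPED (missing-input `Prop`s), NOT attempted.
This is not "finishing BSD".  EVERY theorem here is CONDITIONAL on the ANNOUNCED preprint C.-H. Kim
(app. R. Pollack), arXiv:2505.09121 Thm. 1.1 (`hK25s`, OPEN binder) — a typed OPEN hypothesis, never a theorem.

## What this file proves

* §1 `X6.bsdp_three_rankZero_of_kim2025_OPEN_of_certifiedOddL_of_LValueBall` — N4@3 = X6@3 ∧ `r_an = 0`: `BSD(E,3)` from a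
  LANDED `CertifiedOddL` row (`r.p = 3`, cyclic level `r.n ∈ 𝒩₁`), its rounding certificate and the enclosure (this seat's
  `CertifiedOddL.kuriharaNumber_ne_zero_of_LValueBall`, gen 12) into `GoodThree.bsdp_of_kim2025_OPEN_of_wuthrich_of_
  kuriharaNumber_ne_zero` (B gen 18) with the `3`-adic tower from `ClassX6.towerSurj` (B gen 21: surj(3) and the tower are
  AUTOMATIC on X6 — semistable + irreducible — so, unlike X7/X8, NO image binder and no `surj` certificate is needed) and
  irreducibility from `ClassX6.irr`.  Level `k = 1 ≤ ord₃ ∏c + 1` always: NO Tamagawa binder either.  `hW` (Wuthrich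
  Prop. 21), `hGZK`, `hmod`, `h3per` PUBLISHED.
* §2 `X6.bsdp_three_rankZero_of_kim2025_OPEN_of_ainvs_of_certifiedOddL_of_LValueBall` — the N4@3 RECORD SHAPE: as B's N5@3
  shape with class X6 read off the model by cc-eng-4's `classX6_three_of_intModel` (`3 ∤ Δ`, `#Ẽ(𝔽₃) = 4` i.e. `a_3 = 0`,
  `gcd(Δ, c₄) = 1` i.e. semistable), level `ℓ₁ℓ₂ ∈ 𝒩₁` cyclic by point counts + cube tests (n1011-p15's
  `isCyclicKolyvaginLevel_pair_of_intModel_of_cube`), `A = Π(a_ℓ − 2)`; binders EXACTLY `hK25s` (OPEN), `hW`, `hGZK`, `hmod`,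
  `h3per`, `D`, `r_an = 0`, `hballL`.

The records built on §2 (`X6KuriharaKP3OfferRecords*.lean`, this gen) are the `p = 3` rows of the N4 offer table (17 cells
with a landed two-engine KP3 unit level: `certL3d_X6_*` of `KuriharaTwistRecordsThreeKP3X67RankZero.lean`, x10b gen 11).
Every one of those cells ALREADY carries a descent-side kernel theorem (cc-eng-4 `SEL3CT@3` / B's records, PUBLISHED inputs
only); the Kurihara offer is a SECOND, independent per-pair route, conditional on Kim 2025 — recorded, not booked.

References: tree files `GoodSSTowerOfSurj.lean` (B gen 21), `X8KimTamagawaDefectOPEN.lean` (B gen 18), `X7KuriharaKP3OfferShape.lean`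
(B gen 22), `SecondDescent/CanaryTargetsClassCertificates.lean` (cc-eng-4, `classX6_three_of_intModel`), `KuriharaTwistRecordGeneric
LValues.lean` (x10b gen 12); [Kim2025RefinedTNC] Thm. 1.1 (ANNOUNCED); [Kim2022StructureSelmer] §1.2.2, §1.4.3; [Wuthrich2014]
Lemma 20, Prop. 21; [Serre1972] §5.4 Prop. 21; [MazurTateTeitelbaum1986Invent] §I.8; [CremonaAlgorithms1997] §2.8;
[SilvermanAEC2009] III.1, VII.5; [IrelandRosen1990] Prop. 5.1.2; [Miller2011LMS] Def. 1.1.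
-/

set_option autoImplicit false

noncomputable section

open scoped Classical MatrixGroups ModularForm

open CongruenceSubgroup WeierstrassCurve Literature.NumberTheory.EllipticCurves
  Literature.NumberTheory.EllipticCurves.ModularForms
  Literature.NumberTheory.EllipticCurves.Rank1Residual
  Literature.NumberTheory.EllipticCurves.Rank1Residual.Typed
  Literature.NumberTheory.EllipticCurves.Rank1Residual.X11RankOneCertificates
  Literature.NumberTheory.EllipticCurves.Wuthrich2014
  Summit.BirchSwinnertonDyer.BirchSwinnertonDyer.Rank1Residual.IntModel
  Summit.BirchSwinnertonDyer.BirchSwinnertonDyer.Rank1Residual.X11RankOne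
  Summit.BirchSwinnertonDyer.Rank1Residual.X11b
  Summit.BirchSwinnertonDyer.Rank1Residual.Additive
  Summit.BirchSwinnertonDyer.Rank1Residual.Supersingular.KuriharaTwist

namespace Summit.BirchSwinnertonDyer.Rank1Residual.Supersingular

/-! ### §1 N4@3: the `CertifiedOddL` consumer on X6 (no image binder, no Tamagawa binder) -/

/-- **N4@3 = X6@3 ∧ `r_an = 0`: `BSD(E,3)` from a LANDED `CertifiedOddL` row (`r.p = 3`, cyclic level `r.n ∈ 𝒩₁`),
its rounding certificate and an enclosure of the twisted `L`-value combination** (unit level `k = 1`).  The `3`-adic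
tower and irreducibility are AUTOMATIC on X6 (`ClassX6.towerSurj`, `ClassX6.irr`).  CONDITIONAL on `hK25s` (OPEN) + `hW`
(PUBLISHED); prover A.  Per pair; NOT a class theorem; nothing booked. [claim: Kim2025RefinedTNC, status: under-review]
[cite: Kim2025RefinedTNC, Thm. 1.1 (ANNOUNCED, OPEN binder)] [cite: Kim2022StructureSelmer, §1.4.3 (PDF p. 7)]
[cite: Wuthrich2014, Lemma 20 (p. 399) and Prop. 21 (p. 400)] [cite: Serre1972, §5.4 Prop. 21 i)]
[cite: MazurTateTeitelbaum1986Invent, §I.8 (8.6)] [cite: CremonaAlgorithms1997, §2.8 (2.8.8) (PDF p. 26)] [cite: Miller2011LMS, Def. 1.1] -/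
theorem X6.bsdp_three_rankZero_of_kim2025_OPEN_of_certifiedOddL_of_LValueBall
    (W : WeierstrassCurve ℚ) [W.IsElliptic] [W.IsGloballyMinimal]
    (hK25s : Kim2025.thm11_kimShaLength_of_integralPeriod_OPEN) (hW : sha_dvd_analyticSha)
    (hGZK : rank_eq_analyticRank_of_analyticRank_le_one) (hmod : hasEntireLFunction_rat)
    (h3per : realPeriodRat_eq_unit_mul_plusPeriod_three)
    (hr : W.analyticRank = 0) (hX : ClassX6 W 3)
    {N : ℕ} [NeZero N] (D : ModularParametrizationData W N)
    {rs : List TwistRecord} (hrs : CertifiedOddL rs) {r : TwistRecord} (hr' : r ∈ rs) [Fact r.p.Prime]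
    (hrp : r.p = 3) [NeZero r.n] (hν : r.n.primeFactors.card = r.primes.length)
    (hcyc : IsCyclicKolyvaginLevel W r.p r.n)
    {cs : List RoundingCert} (hcs : RoundingCertifiedHasse cs) {c : RoundingCert} (hc : c ∈ cs)
    (hcp : c.p = r.p) (hcn : c.n = r.n) (hcden : c.den = r.den) (hcbins : c.bins = r.bins)
    (hD' : 0 < c.dstar)
    (ψ : (ℓ : ℕ) → (ZMod ℓ)ˣ →* Multiplicative (ZMod (r.p ^ 1)))
    (hψ : ∀ ℓ ∈ r.n.primeFactors, Function.Surjective (ψ ℓ))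
    (hballL : ∀ (L : ZMod (r.p ^ 1) → ℂ → ℂ), (∀ j, j ≠ 0 → Differentiable ℂ (L j)) →
      (∀ j, j ≠ 0 → ∀ s : ℂ, 2 < s.re → L j s = twistedLSeries D.f (binChar r.n ψ j)⁻¹ s) →
      ∀ k < r.p, ∃ mid rad : ℝ, rad ≤ (c.radNum : ℝ) / 10 ^ c.radExp ∧
        |mid - ((c.binsStar.getD k 0 : ℤ) : ℝ)| ≤ (c.marNum : ℝ) / 10 ^ c.marExp ∧
        |(c.dstar : ℝ) * ((r.components : ℝ) *
          (((∏ ℓ ∈ r.n.primeFactors, ((W.frobeniusTrace ℓ : ℂ) - 2)) * W.entireLFunction 1 +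
            ∑ j ∈ (Finset.univ : Finset (ZMod (r.p ^ 1))).erase 0,
              ZMod.stdAddChar (-(j * (k : ZMod (r.p ^ 1)))) *
                (gaussSum (binChar r.n ψ j) (ZMod.stdAddChar (N := r.n)) * L j 1)).re /
            ((r.p ^ 1 : ℕ) * plusPeriod D.f))) - mid| ≤ rad) :
    BSDp W 3 := by
  obtain ⟨lab, ai, cond, p', n', prs, rts, comp, rk, red, den, bins, dmp, ev⟩ := r
  dsimp only at hrp
  subst hrp
  have hne := CertifiedOddL.kuriharaNumber_ne_zero_of_LValueBall hrs hr' hν D.isNewformOf (by norm_num)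
    (ClassX6.irr W 3 (by decide) hX) hX.1.1 hcyc.1 hcs hc hcp hcn hcden hcbins hD' ψ hψ hballL
  exact GoodThree.bsdp_of_kim2025_OPEN_of_wuthrich_of_kuriharaNumber_ne_zero W hK25s hW hGZK hmod h3per
    hX.1.1 hr (ClassX6.towerSurj W 3 (by decide) hX) D hcyc hcyc.1 (by omega) ψ hψ hne

/-! ### §2 N4@3: the literal-equation RECORD SHAPE (level `ℓ₁ℓ₂ ∈ 𝒩₁`) -/

/-- **N4@3 RECORD SHAPE — `BSD(E,3)` on X6 ∧ `r_an = 0` from the literal equation, a landed `CertifiedOddL` twist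
record + rounding certificate, kernel certificates, and the `L`-value enclosure.**  As B's N5@3 shape
`X7.bsdp_three_rankZero_of_kim2025_OPEN_of_ainvs_of_certifiedOddL_of_LValueBall` minus the additive prime and minus
surj(3): class X6 at `3` is read off the model from `3 ∤ Δ`, `countPoints … 3 = 4` (`a_3 = 0`: good supersingular and
the X6 clause) and `gcd(Δ, c₄) = 1` (semistable) by cc-eng-4's `classX6_three_of_intModel`; the level `ℓ₁ℓ₂ ∈ 𝒩₁` is
cyclic by point counts + cube tests; `A = Π(a_ℓ − 2)`.  REMAINING HYPOTHESES = EXACTLY `hK25s` (OPEN), `hW`, `hGZK`,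
`hmod`, `h3per` (PUBLISHED), `D`, `r_an = 0`, and `hballL`.  Prover A.  Per pair; NOT a class theorem; nothing booked.
[claim: Kim2025RefinedTNC, status: under-review] [cite: Kim2025RefinedTNC, Thm. 1.1 (ANNOUNCED, OPEN binder)]
[cite: Kim2022StructureSelmer, §1.2.2 and §1.4.3 (PDF p. 7)] [cite: Wuthrich2014, Lemma 20 (p. 399) and Prop. 21 (p. 400)]
[cite: MazurTateTeitelbaum1986Invent, §I.8 (8.6)] [cite: CremonaAlgorithms1997, §2.8 (2.8.8) (PDF p. 26)]
[cite: SilvermanAEC2009, III.1, VII.1 Remark 1.1, VII.5 Prop. 5.1(a) and (b)] [cite: IrelandRosen1990, Prop. 5.1.2 and §8.1]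
[cite: Miller2011LMS, Def. 1.1] -/
theorem X6.bsdp_three_rankZero_of_kim2025_OPEN_of_ainvs_of_certifiedOddL_of_LValueBall
    (hK25s : Kim2025.thm11_kimShaLength_of_integralPeriod_OPEN) (hW : sha_dvd_analyticSha)
    (hGZK : rank_eq_analyticRank_of_analyticRank_le_one) (hmod : hasEntireLFunction_rat)
    (h3per : realPeriodRat_eq_unit_mul_plusPeriod_three)
    (a1 a2 a3 a4 a6 : ℤ) (hmin : (⟨a1, a2, a3, a4, a6⟩ : WeierstrassCurve ℚ).IsGloballyMinimal)
    (h3Δ : ¬ (3 : ℤ) ∣ discOf [a1, a2, a3, a4, a6])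
    (hc₃ : countPoints [a1, a2, a3, a4, a6] 3 = (4 : ℕ))
    (hgcd : Int.gcd (discOf [a1, a2, a3, a4, a6]) (c4Of [a1, a2, a3, a4, a6]) = 1)
    -- the landed twist record (`p = 3`, two level primes) and its rounding certificate
    {rs : List TwistRecord} (hrs : CertifiedOddL rs) {r : TwistRecord} (hr : r ∈ rs) [Fact r.p.Prime]
    (hrp : r.p = 3) (hν : r.primes.length = 2)
    {c : RoundingCert} (hcv : c.validHasse = true)
    (hcp : c.p = r.p) (hcn : c.n = r.n) (hcden : c.den = r.den) (hcbins : c.bins = r.bins) (hD' : 0 < c.dstar)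
    -- the cyclic Kolyvagin level `r.n = ℓ₁ · ℓ₂ ∈ 𝒩₁` from point counts and cube tests
    (ℓ₁ ℓ₂ : ℕ) (hne : ℓ₁ ≠ ℓ₂) (h5₁ : 5 ≤ ℓ₁) (h5₂ : 5 ≤ ℓ₂)
    (hΔ₁ : ¬ (ℓ₁ : ℤ) ∣ discOf [a1, a2, a3, a4, a6]) (hΔ₂ : ¬ (ℓ₂ : ℤ) ∣ discOf [a1, a2, a3, a4, a6])
    (h1₁ : ℓ₁ ≡ 1 [MOD 3 ^ 1]) (h1₂ : ℓ₂ ≡ 1 [MOD 3 ^ 1]) {m₁ m₂ : ℕ}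
    (hcnt₁ : Nat.card (((⟨a1, a2, a3, a4, a6⟩ : WeierstrassCurve ℤ).map
      (Int.castRingHom (ZMod ℓ₁))).toAffine.Point) = m₁)
    (hcnt₂ : Nat.card (((⟨a1, a2, a3, a4, a6⟩ : WeierstrassCurve ℤ).map
      (Int.castRingHom (ZMod ℓ₂))).toAffine.Point) = m₂)
    (hd₁ : 3 ^ 1 ∣ m₁) (hd₂ : 3 ^ 1 ∣ m₂)
    (hz₁ : ((discOf [a1, a2, a3, a4, a6] : ℤ) : ZMod ℓ₁) ≠ 0)
    (hχ₁ : ((discOf [a1, a2, a3, a4, a6] : ℤ) : ZMod ℓ₁) ^ ((ℓ₁ - 1) / 3) ≠ 1)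
    (hz₂ : ((discOf [a1, a2, a3, a4, a6] : ℤ) : ZMod ℓ₂) ≠ 0)
    (hχ₂ : ((discOf [a1, a2, a3, a4, a6] : ℤ) : ZMod ℓ₂) ^ ((ℓ₂ - 1) / 3) ≠ 1)
    [hℓ₁ : Fact ℓ₁.Prime] [hℓ₂ : Fact ℓ₂.Prime] [hrn0 : NeZero r.n] (hrn : ℓ₁ * ℓ₂ = r.n)
    {A : ℤ} (hA : A = ((ℓ₁ : ℤ) + 1 - m₁ - 2) * ((ℓ₂ : ℤ) + 1 - m₂ - 2))
    -- the discrete logarithms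
    (ψ₁ : (ZMod ℓ₁)ˣ →* Multiplicative (ZMod (r.p ^ 1))) (hψ₁ : Function.Surjective ψ₁)
    (ψ₂ : (ZMod ℓ₂)ˣ →* Multiplicative (ZMod (r.p ^ 1))) (hψ₂ : Function.Surjective ψ₂)
    -- data binders
    (hr0 : (⟨a1, a2, a3, a4, a6⟩ : WeierstrassCurve ℚ).analyticRank = 0)
    {N : ℕ} [NeZero N] (D : ModularParametrizationData (⟨a1, a2, a3, a4, a6⟩ : WeierstrassCurve ℚ) N)
    -- the engine's enclosure claim, through twisted L-values
    (hballL : ∀ (L : ZMod (r.p ^ 1) → ℂ → ℂ), (∀ j, j ≠ 0 → Differentiable ℂ (L j)) →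
      (∀ j, j ≠ 0 → ∀ s : ℂ, 2 < s.re →
        L j s = twistedLSeries D.f (binChar r.n (pairLogs ℓ₁ ℓ₂ ψ₁ ψ₂) j)⁻¹ s) →
      ∀ k < r.p, ∃ mid rad : ℝ, rad ≤ (c.radNum : ℝ) / 10 ^ c.radExp ∧
        |mid - ((c.binsStar.getD k 0 : ℤ) : ℝ)| ≤ (c.marNum : ℝ) / 10 ^ c.marExp ∧
        |(c.dstar : ℝ) * ((r.components : ℝ) *
          (((A : ℂ) * (⟨a1, a2, a3, a4, a6⟩ : WeierstrassCurve ℚ).entireLFunction 1 +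
            ∑ j ∈ (Finset.univ : Finset (ZMod (r.p ^ 1))).erase 0,
              ZMod.stdAddChar (-(j * (k : ZMod (r.p ^ 1)))) *
                (gaussSum (binChar r.n (pairLogs ℓ₁ ℓ₂ ψ₁ ψ₂) j) (ZMod.stdAddChar (N := r.n)) * L j 1)).re /
            ((r.p ^ 1 : ℕ) * plusPeriod D.f))) - mid| ≤ rad) :
    BSDp (⟨a1, a2, a3, a4, a6⟩ : WeierstrassCurve ℚ) 3 := by
  have h0 : discOf [a1, a2, a3, a4, a6] ≠ 0 := fun h ↦ h3Δ (by rw [h]; exact dvd_zero _)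
  haveI := isElliptic_of_discOf_ne_zero a1 a2 a3 a4 a6 h0
  haveI := hmin
  haveI : Fact (Nat.Prime 3) := ⟨by norm_num⟩
  have hI : integralModelInt (⟨a1, a2, a3, a4, a6⟩ : WeierstrassCurve ℚ) = ⟨a1, a2, a3, a4, a6⟩ :=
    integralModelInt_eq_of_map_eq _ (map_mk_int a1 a2 a3 a4 a6)
  have hΔ₁' : ((⟨a1, a2, a3, a4, a6⟩ : WeierstrassCurve ℤ).map (Int.castRingHom (ZMod ℓ₁))).Δ =
      ((discOf [a1, a2, a3, a4, a6] : ℤ) : ZMod ℓ₁) := by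
    rw [WeierstrassCurve.map_Δ, intCurve_Δ, eq_intCast]
  have hΔ₂' : ((⟨a1, a2, a3, a4, a6⟩ : WeierstrassCurve ℤ).map (Int.castRingHom (ZMod ℓ₂))).Δ =
      ((discOf [a1, a2, a3, a4, a6] : ℤ) : ZMod ℓ₂) := by
    rw [WeierstrassCurve.map_Δ, intCurve_Δ, eq_intCast]
  -- class X6 at `3`
  have hX : ClassX6 (⟨a1, a2, a3, a4, a6⟩ : WeierstrassCurve ℚ) 3 :=
    SecondDescent.classX6_three_of_intModel hI (by rw [intCurve_Δ]; exact h3Δ)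
      (natCard_point_eq_of_countPoints a1 a2 a3 a4 a6 3 (by decide) h3Δ hc₃)
      (by rw [intCurve_Δ, intCurve_c₄]; exact hgcd)
  -- the cyclic Kolyvagin level `ℓ₁ℓ₂ ∈ 𝒩₁`
  have hcyc3 : IsCyclicKolyvaginLevel (⟨a1, a2, a3, a4, a6⟩ : WeierstrassCurve ℚ) 3 (ℓ₁ * ℓ₂) :=
    isCyclicKolyvaginLevel_pair_of_intModel_of_cube hI (k := 1) le_rfl ℓ₁ ℓ₂ hne h5₁ h5₂
      (by rw [intCurve_Δ]; exact hΔ₁) (by rw [intCurve_Δ]; exact hΔ₂) h1₁ h1₂ hcnt₁ hcnt₂ hd₁ hd₂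
      (by rw [hΔ₁']; exact hz₁) (by rw [hΔ₁']; exact hχ₁) (by rw [hΔ₂']; exact hz₂) (by rw [hΔ₂']; exact hχ₂)
  have hcyc : IsCyclicKolyvaginLevel (⟨a1, a2, a3, a4, a6⟩ : WeierstrassCurve ℚ) r.p r.n := by
    rw [hrp, ← hrn]; exact hcyc3
  have hν' : r.n.primeFactors.card = r.primes.length := by
    rw [← hrn, hν, Nat.primeFactors_mul hℓ₁.out.ne_zero hℓ₂.out.ne_zero, hℓ₁.out.primeFactors,
      hℓ₂.out.primeFactors, show ({ℓ₁} ∪ {ℓ₂} : Finset ℕ) = {ℓ₁, ℓ₂} from rfl, Finset.card_pair hne]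
  have hψ : ∀ ℓ ∈ r.n.primeFactors, Function.Surjective (pairLogs ℓ₁ ℓ₂ ψ₁ ψ₂ ℓ) := by
    rw [← hrn]
    exact surjective_pairLogs_of_mem_primeFactors ψ₁ ψ₂ hℓ₁.out hℓ₂.out hne hψ₁ hψ₂
  have hcs : RoundingCertifiedHasse [c] :=
    (RoundingCertifiedHasse.cons_iff c []).2 ⟨hcv, RoundingCertifiedHasse.nil⟩
  have hprod : (∏ ℓ ∈ r.n.primeFactors,
      (((⟨a1, a2, a3, a4, a6⟩ : WeierstrassCurve ℚ).frobeniusTrace ℓ : ℂ) - 2)) = (A : ℂ) := by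
    rw [← hrn]; exact prod_primeFactors_frobeniusTrace_sub_two_eq hI hℓ₁.out hℓ₂.out hne hcnt₁ hcnt₂ hA
  refine X6.bsdp_three_rankZero_of_kim2025_OPEN_of_certifiedOddL_of_LValueBall _ hK25s hW hGZK hmod h3per hr0 hX
    D hrs hr hrp hν' hcyc hcs (List.mem_singleton_self c) hcp hcn hcden hcbins hD' (pairLogs ℓ₁ ℓ₂ ψ₁ ψ₂) hψ ?_
  intro L hL hL' k hk
  obtain ⟨mid, rad, h1, h2, h3⟩ := hballL L hL hL' k hk
  refine ⟨mid, rad, h1, h2, ?_⟩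
  rw [hprod]
  exact h3

end Summit.BirchSwinnertonDyer.Rank1Residual.Supersingular

end
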